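import Summits.CriticalPhenomena.PercolationContinuityZ3.Theorems.PercNearOneGluingNoHeavyQuantLightSliceKnapsack
import Summits.CriticalPhenomena.PercolationContinuityZ3.Theorems.PercNearOneGluingNoHeavyQuantTwoMidTerms
import Summits.CriticalPhenomena.PercolationContinuityZ3.Theorems.PercNearOneGluingNoHeavyQuantLightSliceLowCrossGiant
import Summits.CriticalPhenomena.PercolationContinuityZ3.Theorems.PercNearOneGluingNoHeavyQuantTwoMidCellReal
import HarnessLib

/-!
# QUANT lane R8, T-DEC: **THE CROSSED TYPE II LOW-CROSS CLASS BELOW THE GIANT LINE IS DEC** — the Type II part of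
# `LawDec.LightSliceLowCrossBelow` (`h₂′ < h₂`, `l₁′ + h₂ ≤ j`; two useful mids) closed in the kernel (census-2 g60)

builds on p205010 (kernel theorem, internal audit signed; external expert review pending)

Support file (`--supports stmt-CriticalPhenomena-4575`), QUANT lane seat prim-quant-census-2 (gen 60), rung R8 of `…/quant/LADDER.md`.
Memo `run/shared/lean/prim/quant/prim-quant-census-2-g60/TWO-MID-G60.md`.  Theorems only, standard axioms, no sorries, no definitions.

* `LawDec.lightSlice_decAtT_below_of_twoMid` — THE TWO-MID KNAPSACK FORM: the light slice (eight-term law, `lightSlice_eq_terms`) of the class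
  with the lows `p+l, p+l′, m+l, m+l′`, the head mid `p+h′`, the second mid `p+h ≤ j` and the giants `m+h′, m+h` is `DECAtT` as soon as the
  REDUCED two-mid price inequality holds (each low priced against its own row's mid only) — via `decAtT_of_twoMid_terms`.
* **`LawDec.lightSlice_decAtT_lowCross_below_crossed`** — floor `0 < x < 1`; side 1's light credit pair `{p, m}` at `T₁` (`2p < T₁ < p+m`,
  `m ≤ j`, `m ≤ M₁`, usage `< u`); side 2's admissible atom `(l, h; l′, h′)` at `T₂` (`AtomData`), STRICTLY crossed (`l < l′`, `h′ < h`); the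
  residue geometry of `LightSliceLowCrossBelow`: ¬A2 `T₁+T₂ ≤ 2(p+h′)`, top giant `j+1 ≤ m+h′`, LOW CROSS `2(m+l′) < T₁+T₂`, and the second
  mid below the giant line `p + h ≤ j`.  Then the light slice `lconv M₁ M₂ (TP[p, m; gateOf x T₁ j p m]) (atomLaw x T₂ j l h l′ h′)` is
  `DECAtT x (T₁+T₂) j (M₁+M₂)`.
PROOF.  Rates from the spans (`r`, `ρc`, `a`, `ρe`, `ε`; the cross pairs `P2, M2 → p+h′` and `P1, M1 → p+h` have rates `ρc + ra`,
`(ρc + ra − 2a)/(1−a)`, `ρe + ra/ε`, `ρe − a(2−ρe−r)/(ε−a)`; Type II strictness reads `2 − ρc < ε(2 − ρe)`), usages by `usage_eq_Ul/Uh`,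
and the cell inequality `TwoMidCell.main` (`…QuantTwoMidCellReal`).  Together with `lightSlice_decAtT_lowCross_crossGiant` (census-2 g59) this
settles every crossed Type II pair of `LightSliceLowCross`; the Type I pairs are `…QuantLightSliceLowCrossBelowTypeI`.
EXACT CENSUS: 3 885 instances of this class at M ≤ 8 (kit j162002/j163808), 0 light-slice failures.

[this work].  The gluing rows served [cite: KozmaNitzan2024, Conjecture 3 (p. 15)]; product measure [cite: Grimmett1999, §1.3 p. 10].
-/

noncomputable section

namespace Summit.CriticalPhenomena.PercolationContinuityZ3.Theorems

namespace Quant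

open Finset

/-- the two-point law `{lo, hi; g}` (as in `…QuantLawDEC`) -/
local notation3 "TP[" lo ", " hi ", " g ", " h "]" =>
  (g : ℝ) * (if (h : ℕ) = (hi : ℕ) then (1 : ℝ) else 0) + (1 - (g : ℝ)) * (if (h : ℕ) = (lo : ℕ) then (1 : ℝ) else 0)

namespace LawDec

/-- `min 1 (min A B) ≤ min 1 B` -/
theorem min_one_min_le_right (A B : ℝ) : min 1 (min A B) ≤ min 1 B :=
  min_le_min le_rfl (min_le_right A B)

/-- `min 1 (min A B) ≤ min 1 A` -/
theorem min_one_min_le_left (A B : ℝ) : min 1 (min A B) ≤ min 1 A :=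
  min_le_min le_rfl (min_le_left A B)

/-- `min 1 (min A B) ≤ 1` -/
theorem min_one_min_le_one (A B : ℝ) : min 1 (min A B) ≤ 1 := min_le_left _ _

/-- **TWO-MID KNAPSACK FORM OF THE CROSSED TYPE II LOW-CROSS CLASS BELOW THE GIANT LINE (`p + h ≤ j`).**  Light pair `{p, m}` (`p < m`) with
gate `γ ∈ [0,1]`, atom positions `l < l′`, `h′ < h` with rates `0 ≤ c₂ < u < c₁`; the head mid `p + h′` (`T ≤ 2(p + h′)`) and the second mid
`p + h ≤ j`; the cross cell `m + l′` a conv-low compatible with the head mid (`2(m + l′) < T < (m + l′) + (p + h′)`), the cell `m + l`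
compatible with the second mid (`T < (m + l) + (p + h)`); giants `m + h′ ≥ j + 1` (hence `m + h`); tops `m ≤ M₁`, `h ≤ M₂`.  If for all prices
`β₁, β₂ ≥ 0` the REDUCED two-mid inequality holds — row-`p` lows priced only against their own row's mid (`p + l → p + h`, `p + l′ → p + h′`,
when compatible), row-`m` lows likewise (`m + l → p + h`, `m + l′ → p + h′`), giants at `1/u` — then the light slice is `DECAtT x T j (M₁+M₂)`.
[this work] -/
theorem lightSlice_decAtT_below_of_twoMid (x T T₂ γ : ℝ) (M₁ M₂ j p m l h l' h' : ℕ) (hx0 : 0 < x) (hx1 : x < 1)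
    (hγ0 : 0 ≤ γ) (hγ1 : γ ≤ 1) (hc₂0 : 0 ≤ usage x T₂ j l' h') (hc₂u : usage x T₂ j l' h' < x / (1 - x)) (huc₁ : x / (1 - x) < usage x T₂ j l h)
    (hpm : p < m) (hll' : l < l') (hh'h : h' < h) (hmM : m ≤ M₁) (hhM : h ≤ M₂)
    (hlow : 2 * ((m : ℝ) + l') < T) (hbelow : m + l' < p + h')
    (hPGj : p + h ≤ j) (hMH : j + 1 ≤ m + h')
    (hM2c : T < ((m : ℝ) + l') + ((p : ℝ) + h')) (hM1c : T < ((m : ℝ) + l) + ((p : ℝ) + h))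
    (hdual : ∀ β₁ β₂ : ℝ, 0 ≤ β₁ → 0 ≤ β₂ →
      (1 - γ) * ((1 - x) / (usage x T₂ j l h - usage x T₂ j l' h') * (x / (1 - x) - usage x T₂ j l' h'))
          * (if T < ((p : ℝ) + l) + ((p : ℝ) + h) then min 1 (usage x T j (p + l) (p + h) * β₂) else 1)
        + (1 - γ) * ((1 - x) / (usage x T₂ j l h - usage x T₂ j l' h') * (usage x T₂ j l h - x / (1 - x)))
          * (if T < ((p : ℝ) + l') + ((p : ℝ) + h') then min 1 (usage x T j (p + l') (p + h') * β₁) else 1)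
        + γ * ((1 - x) / (usage x T₂ j l h - usage x T₂ j l' h') * (x / (1 - x) - usage x T₂ j l' h'))
          * min 1 (usage x T j (m + l) (p + h) * β₂)
        + γ * ((1 - x) / (usage x T₂ j l h - usage x T₂ j l' h') * (usage x T₂ j l h - x / (1 - x)))
          * min 1 (usage x T j (m + l') (p + h') * β₁)
      ≤ β₁ * ((1 - γ) * ((1 - x) / (usage x T₂ j l h - usage x T₂ j l' h') * (usage x T₂ j l h - x / (1 - x)) * usage x T₂ j l' h'))
        + β₂ * ((1 - γ) * ((1 - x) / (usage x T₂ j l h - usage x T₂ j l' h') * (x / (1 - x) - usage x T₂ j l' h') * usage x T₂ j l h))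
        + ((1 - x) / x) *
          (γ * ((1 - x) / (usage x T₂ j l h - usage x T₂ j l' h') * (x / (1 - x) - usage x T₂ j l' h') * usage x T₂ j l h)
            + γ * ((1 - x) / (usage x T₂ j l h - usage x T₂ j l' h') * (usage x T₂ j l h - x / (1 - x)) * usage x T₂ j l' h'))) :
    DECAtT x T j (M₁ + M₂) (lconv M₁ M₂ (fun b => TP[p, m, γ, b]) (atomLaw x T₂ j l h l' h')) := by
  have h1x : 0 < 1 - x := by linarith
  have hK : 0 ≤ (1 - x) / (usage x T₂ j l h - usage x T₂ j l' h') := div_nonneg h1x.le (by linarith)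
  have hmE : 0 ≤ (1 - x) / (usage x T₂ j l h - usage x T₂ j l' h') * (x / (1 - x) - usage x T₂ j l' h') := mul_nonneg hK (by linarith)
  have hmC : 0 ≤ (1 - x) / (usage x T₂ j l h - usage x T₂ j l' h') * (usage x T₂ j l h - x / (1 - x)) := mul_nonneg hK (by linarith)
  have hc₁0 : 0 ≤ usage x T₂ j l h := by have := div_pos hx0 h1x; linarith
  -- classification of the eight positions
  have hq1 : p + l ≤ j ∧ 2 * ((p : ℝ) + l) < T := ⟨by omega, by
    have : ((p : ℝ) + l) ≤ (m : ℝ) + l' := by exact_mod_cast (show p + l ≤ m + l' by omega)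
    linarith⟩
  have hq3 : p + l' ≤ j ∧ 2 * ((p : ℝ) + l') < T := ⟨by omega, by
    have : ((p : ℝ) + l') ≤ (m : ℝ) + l' := by exact_mod_cast (show p + l' ≤ m + l' by omega)
    linarith⟩
  have hq5 : m + l ≤ j ∧ 2 * ((m : ℝ) + l) < T := ⟨by omega, by
    have : ((m : ℝ) + l) ≤ (m : ℝ) + l' := by exact_mod_cast (show m + l ≤ m + l' by omega)
    linarith⟩
  have hq7 : m + l' ≤ j ∧ 2 * ((m : ℝ) + l') < T := ⟨by omega, hlow⟩
  have hn2 : ¬ (p + h ≤ j ∧ 2 * ((p : ℝ) + h) < T) := fun hc => by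
    have : ((p : ℝ) + h') ≤ (p : ℝ) + h := by exact_mod_cast (show p + h' ≤ p + h by omega)
    linarith [hc.2]
  have hn4 : ¬ (p + h' ≤ j ∧ 2 * ((p : ℝ) + h') < T) := fun hc => by linarith [hc.2]
  obtain ⟨hn6, hn8⟩ : ¬ (m + h ≤ j ∧ 2 * ((m : ℝ) + h) < T) ∧ ¬ (m + h' ≤ j ∧ 2 * ((m : ℝ) + h') < T) :=
    ⟨fun hc => by omega, fun hc => by omega⟩
  obtain ⟨hg1, hg2, hg3, hg4⟩ : ¬ (j + 1 ≤ p + l) ∧ ¬ (j + 1 ≤ p + h) ∧ ¬ (j + 1 ≤ p + l') ∧ ¬ (j + 1 ≤ p + h') :=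
    ⟨by omega, by omega, by omega, by omega⟩
  obtain ⟨hg5, hg6, hg7, hg8⟩ : ¬ (j + 1 ≤ m + l) ∧ (j + 1 ≤ m + h) ∧ ¬ (j + 1 ≤ m + l') ∧ (j + 1 ≤ m + h') :=
    ⟨by omega, by omega, by omega, hMH⟩
  -- which terms sit at the two mids
  obtain ⟨ha1, ha2, ha3, ha5, ha6, ha7, ha8⟩ : p + l ≠ p + h' ∧ p + h ≠ p + h' ∧ p + l' ≠ p + h' ∧ m + l ≠ p + h' ∧ m + h ≠ p + h' ∧
      m + l' ≠ p + h' ∧ m + h' ≠ p + h' := ⟨by omega, by omega, by omega, by omega, by omega, by omega, by omega⟩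
  obtain ⟨hb1, hb3, hb4, hb5, hb6, hb7, hb8⟩ : p + l ≠ p + h ∧ p + l' ≠ p + h ∧ p + h' ≠ p + h ∧ m + l ≠ p + h ∧ m + h ≠ p + h ∧
      m + l' ≠ p + h ∧ m + h' ≠ p + h := ⟨by omega, by omega, by omega, by omega, by omega, by omega, by omega⟩
  have hz : ∀ b, M₂ < b → atomLaw x T₂ j l h l' h' b = 0 := fun b hb =>
    atomLaw_eq_zero_of_gt x T₂ j l h l' h' (by omega) hhM (by omega) (by omega) hb
  rw [lightSlice_eq_terms x T₂ γ M₁ M₂ j p m l h l' h' (by omega) hhM (by omega) (by omega) (by omega) hmM]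
  refine decAtT_of_twoMid_terms x T j (M₁ + M₂) (p + h') (p + h) _ _ hx0 hx1 ?_ ?_ ?_ (by omega) (by omega)
    (by push_cast; linarith) hPGj (by omega) (by push_cast; intro hc; exact hn2 ⟨hPGj, hc⟩) (by omega) ?_
  · intro i
    fin_cases i <;> first
      | exact mul_nonneg (by linarith) hmE
      | exact mul_nonneg (by linarith) (mul_nonneg hmE hc₁0)
      | exact mul_nonneg (by linarith) hmC
      | exact mul_nonneg (by linarith) (mul_nonneg hmC hc₂0)
  · have hcc : usage x T₂ j l h - usage x T₂ j l' h' ≠ 0 := by linarith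
    have h1x' : (1 : ℝ) - x ≠ 0 := h1x.ne'
    simp only [Fin.sum_univ_eight, Matrix.cons_val_zero, Matrix.cons_val_one, Matrix.cons_val]
    field_simp
    ring
  · intro i
    fin_cases i <;> simp <;> omega
  · intro β₁ β₂ hβ₁ hβ₂
    have key := hdual β₁ β₂ hβ₁ hβ₂
    simp only [Fin.sum_univ_eight, Matrix.cons_val_zero, Matrix.cons_val_one, Matrix.cons_val, Nat.cast_add,
      if_pos hq1, if_neg hn2, if_pos hq3, if_neg hn4, if_pos hq5, if_neg hn6, if_pos hq7, if_neg hn8,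
      if_neg hg1, if_neg hg2, if_neg hg3, if_neg hg4, if_neg hg5, if_pos hg6, if_neg hg7, if_pos hg8,
      if_neg ha1, if_neg ha2, if_neg ha3, if_neg ha5, if_neg ha6, if_neg ha7, if_neg ha8,
      if_neg hb1, if_neg hb3, if_neg hb4, if_neg hb5, if_neg hb6, if_neg hb7, if_neg hb8,
      if_true, zero_add, add_zero, if_pos hM2c, if_pos hM1c]
    -- reduce each low term to the one option kept in `hdual`
    have t1 : (1 - γ) * ((1 - x) / (usage x T₂ j l h - usage x T₂ j l' h') * (x / (1 - x) - usage x T₂ j l' h'))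
          * min 1 (min (if T < ((p : ℝ) + l) + ((p : ℝ) + h') then usage x T j (p + l) (p + h') * β₁ else 1)
                       (if T < ((p : ℝ) + l) + ((p : ℝ) + h) then usage x T j (p + l) (p + h) * β₂ else 1))
        ≤ (1 - γ) * ((1 - x) / (usage x T₂ j l h - usage x T₂ j l' h') * (x / (1 - x) - usage x T₂ j l' h'))
          * (if T < ((p : ℝ) + l) + ((p : ℝ) + h) then min 1 (usage x T j (p + l) (p + h) * β₂) else 1) := by
      refine mul_le_mul_of_nonneg_left ?_ (mul_nonneg (by linarith) hmE)
      split_ifs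
      · exact min_one_min_le_right _ _
      · exact min_one_min_le_one _ _
      · exact min_one_min_le_right _ _
      · exact min_one_min_le_one _ _
    have t2 : (1 - γ) * ((1 - x) / (usage x T₂ j l h - usage x T₂ j l' h') * (usage x T₂ j l h - x / (1 - x)))
          * min 1 (min (if T < ((p : ℝ) + l') + ((p : ℝ) + h') then usage x T j (p + l') (p + h') * β₁ else 1)
                       (if T < ((p : ℝ) + l') + ((p : ℝ) + h) then usage x T j (p + l') (p + h) * β₂ else 1))
        ≤ (1 - γ) * ((1 - x) / (usage x T₂ j l h - usage x T₂ j l' h') * (usage x T₂ j l h - x / (1 - x)))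
          * (if T < ((p : ℝ) + l') + ((p : ℝ) + h') then min 1 (usage x T j (p + l') (p + h') * β₁) else 1) := by
      refine mul_le_mul_of_nonneg_left ?_ (mul_nonneg (by linarith) hmC)
      split_ifs
      · exact min_one_min_le_left _ _
      · exact min_one_min_le_left _ _
      · exact min_one_min_le_one _ _
      · exact min_one_min_le_one _ _
    have t3 : γ * ((1 - x) / (usage x T₂ j l h - usage x T₂ j l' h') * (x / (1 - x) - usage x T₂ j l' h'))
          * min 1 (min (if T < ((m : ℝ) + l) + ((p : ℝ) + h') then usage x T j (m + l) (p + h') * β₁ else 1)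
                       (usage x T j (m + l) (p + h) * β₂))
        ≤ γ * ((1 - x) / (usage x T₂ j l h - usage x T₂ j l' h') * (x / (1 - x) - usage x T₂ j l' h'))
          * min 1 (usage x T j (m + l) (p + h) * β₂) :=
      mul_le_mul_of_nonneg_left (min_one_min_le_right _ _) (mul_nonneg hγ0 hmE)
    have t4 : γ * ((1 - x) / (usage x T₂ j l h - usage x T₂ j l' h') * (usage x T₂ j l h - x / (1 - x)))
          * min 1 (min (usage x T j (m + l') (p + h') * β₁)
                       (if T < ((m : ℝ) + l') + ((p : ℝ) + h) then usage x T j (m + l') (p + h) * β₂ else 1))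
        ≤ γ * ((1 - x) / (usage x T₂ j l h - usage x T₂ j l' h') * (usage x T₂ j l h - x / (1 - x)))
          * min 1 (usage x T j (m + l') (p + h') * β₁) :=
      mul_le_mul_of_nonneg_left (min_one_min_le_left _ _) (mul_nonneg hγ0 hmC)
    linarith [t1, t2, t3, t4, key]

/-- light usage `U_ℓ(ρ)` (class-level copy of the notation) -/
local notation3 "UL'[" x ", " ρ "]" => ((x : ℝ) ^ 2 + (1 - x) * ρ) / ((1 - x) * (1 + x - ρ))

set_option maxHeartbeats 4000000 in
/-- **THE CROSSED TYPE II LOW-CROSS CLASS BELOW THE GIANT LINE IS DEC.**  See the module docstring. [this work] -/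
theorem lightSlice_decAtT_lowCross_below_crossed (x T₁ T₂ : ℝ) (M₁ M₂ j p m l h l' h' : ℕ) (hx0 : 0 < x) (hx1 : x < 1)
    (hlow₁ : 2 * (p : ℝ) < T₁) (hmj : m ≤ j) (hmM : m ≤ M₁) (hc₁ : T₁ < (p : ℝ) + m) (hlight₁ : usage x T₁ j p m < x / (1 - x))
    (hd₂ : AtomData x T₂ j M₂ l h l' h') (hll' : l < l') (hh'h : h' < h)
    (hA2 : T₁ + T₂ ≤ 2 * ((p : ℝ) + h')) (htop : j + 1 ≤ m + h') (hlow : 2 * ((m : ℝ) + l') < T₁ + T₂)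
    (hbelow : p + h ≤ j) :
    DECAtT x (T₁ + T₂) j (M₁ + M₂) (lconv M₁ M₂ (fun b => TP[p, m, gateOf x T₁ j p m, b]) (atomLaw x T₂ j l h l' h')) := by
  classical
  obtain ⟨hlh, hl'h'⟩ := hd₂.lt_of
  obtain ⟨-, a2, a3, a4, a5, -, b2, b3, -, b5, -, c2, c1⟩ := hd₂
  have hdeep : p + h' ≤ j := by omega
  have hpm' : (p : ℝ) < m := by linarith
  have hpm : p < m := by exact_mod_cast hpm'
  have hlh'' : (l' : ℝ) < h' := by exact_mod_cast hl'h'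
  have hlh' : (l : ℝ) < h := by exact_mod_cast hlh
  have h1x : 0 < 1 - x := by linarith
  have hu0 : 0 < x / (1 - x) := div_pos hx0 h1x
  obtain ⟨hγx2, hγ1⟩ := gateOf_bounds x T₁ j p m hx0 hx1 hlow₁ hmj hc₁
  have hγx : gateOf x T₁ j p m < x := gate_lt_of_usage_lt x T₁ j p m hx1 hγ1 hlight₁
  have hγ0 : 0 ≤ gateOf x T₁ j p m := by nlinarith
  have hc₂0 : 0 ≤ usage x T₂ j l' h' := (usage_pos_of_compat x T₂ j l' h' hx0 hx1 b2 hl'h' (Or.inr b5)).le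
  -- ### spans and rates
  have hA0 : (0 : ℝ) < (m : ℝ) - p := by linarith
  have hB0 : (0 : ℝ) < (h' : ℝ) - l' := by linarith
  have hE0 : (0 : ℝ) < (h : ℝ) - l := by linarith
  obtain ⟨r, hr⟩ : ∃ r : ℝ, r = (T₁ - 2 * (p : ℝ)) / ((m : ℝ) - p) := ⟨_, rfl⟩
  obtain ⟨ρc, hρc⟩ : ∃ ρc : ℝ, ρc = (T₂ - 2 * (l' : ℝ)) / ((h' : ℝ) - l') := ⟨_, rfl⟩
  obtain ⟨a, ha⟩ : ∃ a : ℝ, a = ((m : ℝ) - p) / ((h' : ℝ) - l') := ⟨_, rfl⟩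
  obtain ⟨ρe, hρe⟩ : ∃ ρe : ℝ, ρe = (T₂ - 2 * (l : ℝ)) / ((h : ℝ) - l) := ⟨_, rfl⟩
  obtain ⟨ε, hε⟩ : ∃ ε : ℝ, ε = ((h : ℝ) - l) / ((h' : ℝ) - l') := ⟨_, rfl⟩
  have hrA : r * ((m : ℝ) - p) = T₁ - 2 * (p : ℝ) := by rw [hr]; field_simp
  have hρB : ρc * ((h' : ℝ) - l') = T₂ - 2 * (l' : ℝ) := by rw [hρc]; field_simp
  have haB : a * ((h' : ℝ) - l') = (m : ℝ) - p := by rw [ha]; field_simp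
  have hρeE : ρe * ((h : ℝ) - l) = T₂ - 2 * (l : ℝ) := by rw [hρe]; field_simp
  have hεB : ε * ((h' : ℝ) - l') = (h : ℝ) - l := by rw [hε]; field_simp
  have hr0 : 0 ≤ r := by rw [hr]; exact div_nonneg (by linarith) hA0.le
  have hrx : r < x := rate_lt_of_usage_lt x T₁ j p m r hx1 hmj hA0 hrA hγ1 hlight₁
  obtain ⟨-, hg2'⟩ := gateOf_bounds x T₂ j l' h' hx0 hx1 b2 b3 b5
  have hρcx : ρc < x := rate_lt_of_usage_lt x T₂ j l' h' ρc hx1 b3 hB0 hρB hg2' c2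
  have ha0 : 0 < a := by rw [ha]; exact div_pos hA0 hB0
  have hε0 : 0 < ε := by rw [hε]; exact div_pos hE0 hB0
  -- low cross in the rates: (2 - r) a < ρc
  have hraB : r * (a * ((h' : ℝ) - l')) = r * ((m : ℝ) - p) := by rw [haB]
  have hlc : (2 - r) * a < ρc := by
    have key : ((2 - r) * a) * ((h' : ℝ) - l') < ρc * ((h' : ℝ) - l') := by linarith [hraB, hrA, hρB, haB]
    exact lt_of_mul_lt_mul_right key hB0.le
  have ha1 : a < 1 := by nlinarith
  have h1a : 0 < 1 - a := by linarith
  -- the expensive rate: heavy and compatible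
  have hρe1 : ρe < 1 := by
    have : ρe * ((h : ℝ) - l) < 1 * ((h : ℝ) - l) := by rw [hρeE]; linarith
    exact lt_of_mul_lt_mul_right this hE0.le
  have hρex : x < ρe := by
    by_contra hle
    push Not at hle
    obtain ⟨-, hg1e⟩ := gateOf_bounds x T₂ j l h hx0 hx1 a2 a3 a5
    have hUl := usage_eq_Ul x T₂ j l h ρe hx0 hx1 a3 a2 a5 hρeE hle
    have : usage x T₂ j l h ≤ x / (1 - x) := by rw [hUl]; exact CrossGiantCell.Ul_le_u x ρe hx0 hx1 hle
    linarith
  -- Type II strictness in the rates: 2 - ρc < ε (2 - ρe)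
  have hdII : 2 - ρc < ε * (2 - ρe) := by
    have e1 : (2 - ρc) * ((h' : ℝ) - l') = 2 * (h' : ℝ) - T₂ := by linarith [hρB]
    have e2 : ε * (2 - ρe) * ((h' : ℝ) - l') = 2 * (h : ℝ) - T₂ := by
      have : ε * (2 - ρe) * ((h' : ℝ) - l') = (2 - ρe) * (ε * ((h' : ℝ) - l')) := by ring
      rw [this, hεB]; linarith [hρeE]
    have hlt : (2 - ρc) * ((h' : ℝ) - l') < ε * (2 - ρe) * ((h' : ℝ) - l') := by
      rw [e1, e2]; have : (h' : ℝ) < h := by exact_mod_cast hh'h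
      linarith
    exact lt_of_mul_lt_mul_right hlt hB0.le
  -- ### the gate and the atom's rates in closed form
  have hγ : gateOf x T₁ j p m = x ^ 2 + (1 - x) * r := by
    rw [gateOf_of_le x T₁ j p m hmj, pairGate_eq_light x T₁ p m hx0.le (by rw [← hr]; exact hrx.le), ← hr]
  have hc₂v : usage x T₂ j l' h' = UL'[x, ρc] := usage_eq_Ul x T₂ j l' h' ρc hx0 hx1 b3 b2 b5 hρB hρcx.le
  have hc₁v : usage x T₂ j l h = ρe / (1 - ρe) := usage_eq_Uh x T₂ j l h ρe hx0 hx1 a3 a2 a5 hρeE hρex.le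
  -- ### the head-mid pairs P2 = p + l', M2 = m + l' (as in the crossed class)
  obtain ⟨P, hP⟩ : ∃ P : ℝ, P = ρc + r * a := ⟨_, rfl⟩
  obtain ⟨M, hM⟩ : ∃ M : ℝ, M = (ρc + r * a - 2 * a) / (1 - a) := ⟨_, rfl⟩
  have hPB : P * ((h' : ℝ) - l') = (T₁ + T₂) - 2 * ((p : ℝ) + l') := by rw [hP]; linarith [hraB, hrA, hρB]
  have hMB : M * ((1 - a) * ((h' : ℝ) - l')) = (T₁ + T₂) - 2 * ((m : ℝ) + l') := by
    have e : M * ((1 - a) * ((h' : ℝ) - l')) = (ρc + r * a - 2 * a) * ((h' : ℝ) - l') := by rw [hM]; field_simp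
    rw [e]; linarith [hPB, haB, hP]
  have hPspan : P * ((((p + h' : ℕ) : ℝ)) - ((p + l' : ℕ) : ℝ)) = (T₁ + T₂) - 2 * (((p + l' : ℕ) : ℝ)) := by
    push_cast
    have e : ((p : ℝ) + h' - ((p : ℝ) + l')) = (h' : ℝ) - l' := by ring
    rw [e, hPB]
  have hMspan : M * ((((p + h' : ℕ) : ℝ)) - ((m + l' : ℕ) : ℝ)) = (T₁ + T₂) - 2 * (((m + l' : ℕ) : ℝ)) := by
    push_cast
    have e : ((p : ℝ) + h' - ((m : ℝ) + l')) = (1 - a) * ((h' : ℝ) - l') := by linarith [haB]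
    rw [e, hMB]
  have hMx : M < x := by
    rw [hM, div_lt_iff₀ h1a]
    have : ρc + r * a - x < r * a := by linarith
    nlinarith [mul_pos ha0 h1x]
  have hdM : (0 : ℝ) < ((p + h' : ℕ) : ℝ) - ((m + l' : ℕ) : ℝ) := by push_cast; linarith
  have hcompM : T₁ + T₂ < ((m + l' : ℕ) : ℝ) + ((p + h' : ℕ) : ℝ) := by push_cast; linarith
  have hlowM : 2 * (((m + l' : ℕ) : ℝ)) < T₁ + T₂ := by push_cast; exact hlow
  have hM2 : usage x (T₁ + T₂) j (m + l') (p + h') = UL'[x, M] :=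
    usage_eq_Ul x (T₁ + T₂) j (m + l') (p + h') M hx0 hx1 hdeep hlowM hcompM hMspan hMx.le
  have hM2compat : T₁ + T₂ < ((m : ℝ) + l') + ((p : ℝ) + h') := by push_cast at hcompM; linarith
  have hbelow' : m + l' < p + h' := by
    have : ((m : ℝ) + l') < (p : ℝ) + h' := by linarith
    exact_mod_cast this
  have hcP2 : (T₁ + T₂ < ((p : ℝ) + l') + ((p : ℝ) + h')) ↔ P < 1 := by
    constructor
    · intro hc
      have : P * ((h' : ℝ) - l') < 1 * ((h' : ℝ) - l') := by rw [hPB]; linarith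
      exact lt_of_mul_lt_mul_right this hB0.le
    · intro hP1
      have : P * ((h' : ℝ) - l') < 1 * ((h' : ℝ) - l') := mul_lt_mul_of_pos_right hP1 hB0
      rw [hPB] at this; linarith
  have hlowP : 2 * (((p + l' : ℕ) : ℝ)) < T₁ + T₂ := by push_cast; linarith
  have hUP2l : P ≤ x → usage x (T₁ + T₂) j (p + l') (p + h') = UL'[x, P] := by
    intro hPx
    have hc : T₁ + T₂ < ((p : ℝ) + l') + ((p : ℝ) + h') := hcP2.2 (by linarith)
    have hcompP : T₁ + T₂ < ((p + l' : ℕ) : ℝ) + ((p + h' : ℕ) : ℝ) := by push_cast; exact hc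
    exact usage_eq_Ul x (T₁ + T₂) j (p + l') (p + h') P hx0 hx1 hdeep hlowP hcompP hPspan hPx
  have hUP2h : x ≤ P → P < 1 → usage x (T₁ + T₂) j (p + l') (p + h') = P / (1 - P) := by
    intro hPx hP1
    have hc : T₁ + T₂ < ((p : ℝ) + l') + ((p : ℝ) + h') := hcP2.2 hP1
    have hcompP : T₁ + T₂ < ((p + l' : ℕ) : ℝ) + ((p + h' : ℕ) : ℝ) := by push_cast; exact hc
    exact usage_eq_Uh x (T₁ + T₂) j (p + l') (p + h') P hx0 hx1 hdeep hlowP hcompP hPspan hPx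
  -- ### the second-mid pairs P1 = p + l, M1 = m + l into p + h
  obtain ⟨ρS, hρS⟩ : ∃ ρS : ℝ, ρS = ρe + r * a / ε := ⟨_, rfl⟩
  obtain ⟨ρN, hρN⟩ : ∃ ρN : ℝ, ρN = ρe - a * (2 - ρe - r) / (ε - a) := ⟨_, rfl⟩
  have haE : a / ε * ((h : ℝ) - l) = (m : ℝ) - p := by
    rw [← hεB, ← haB]; field_simp
  have hSE : ρS * ((h : ℝ) - l) = (T₁ + T₂) - 2 * ((p : ℝ) + l) := by
    rw [hρS]
    have : (ρe + r * a / ε) * ((h : ℝ) - l) = ρe * ((h : ℝ) - l) + r * (a / ε * ((h : ℝ) - l)) := by ring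
    rw [this, hρeE, haE, hrA]; ring
  have hSspan : ρS * ((((p + h : ℕ) : ℝ)) - ((p + l : ℕ) : ℝ)) = (T₁ + T₂) - 2 * (((p + l : ℕ) : ℝ)) := by
    push_cast
    have e : ((p : ℝ) + h - ((p : ℝ) + l)) = (h : ℝ) - l := by ring
    rw [e, hSE]
  have hεa : a < ε := by
    -- `m + l' < p + h'` and `h' < h` give `m - p < h - l`
    rw [ha, hε, div_lt_div_iff_of_pos_right hB0]
    have h1 : ((m : ℝ) + l') < (p : ℝ) + h' := by exact_mod_cast hbelow'
    have h2 : (h' : ℝ) < h := by exact_mod_cast hh'h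
    have h3 : (l : ℝ) < l' := by exact_mod_cast hll'
    linarith
  have hεa' : 0 < ε - a := by linarith
  have hNspanE : ρN * ((ε - a) * ((h' : ℝ) - l')) = (T₁ + T₂) - 2 * ((m : ℝ) + l) := by
    rw [hρN]
    have e : (ρe - a * (2 - ρe - r) / (ε - a)) * ((ε - a) * ((h' : ℝ) - l'))
        = ρe * (ε * ((h' : ℝ) - l')) - 2 * (a * ((h' : ℝ) - l')) + r * (a * ((h' : ℝ) - l')) := by
      field_simp
      ring
    rw [e, hεB, hρeE, haB, hrA]; ring
  have hspanN : (((p + h : ℕ) : ℝ)) - ((m + l : ℕ) : ℝ) = (ε - a) * ((h' : ℝ) - l') := by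
    push_cast
    have : (ε - a) * ((h' : ℝ) - l') = ε * ((h' : ℝ) - l') - a * ((h' : ℝ) - l') := by ring
    rw [this, hεB, haB]; ring
  have hNspan : ρN * ((((p + h : ℕ) : ℝ)) - ((m + l : ℕ) : ℝ)) = (T₁ + T₂) - 2 * (((m + l : ℕ) : ℝ)) := by
    rw [hspanN, hNspanE]; push_cast; ring
  have hρNe : ρN ≤ ρe := by
    rw [hρN]; linarith [div_nonneg (mul_nonneg ha0.le (by linarith : (0:ℝ) ≤ 2 - ρe - r)) hεa'.le]
  have hdN : (0 : ℝ) < ((p + h : ℕ) : ℝ) - ((m + l : ℕ) : ℝ) := by rw [hspanN]; positivity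
  have hll'r : (l : ℝ) < l' := by exact_mod_cast hll'
  have hlowN : 2 * (((m + l : ℕ) : ℝ)) < T₁ + T₂ := by push_cast; linarith
  have hM1c : T₁ + T₂ < ((m : ℝ) + l) + ((p : ℝ) + h) := by
    have h1 : ρN * ((((p + h : ℕ) : ℝ)) - ((m + l : ℕ) : ℝ)) < 1 * ((((p + h : ℕ) : ℝ)) - ((m + l : ℕ) : ℝ)) :=
      mul_lt_mul_of_pos_right (by linarith) hdN
    rw [hNspan] at h1; push_cast at h1; linarith
  have hcompN : T₁ + T₂ < ((m + l : ℕ) : ℝ) + ((p + h : ℕ) : ℝ) := by push_cast; linarith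
  have hUM1l : ρN ≤ x → usage x (T₁ + T₂) j (m + l) (p + h) = UL'[x, ρN] := fun hNx =>
    usage_eq_Ul x (T₁ + T₂) j (m + l) (p + h) ρN hx0 hx1 hbelow hlowN hcompN hNspan hNx
  have hUM1h : x ≤ ρN → usage x (T₁ + T₂) j (m + l) (p + h) = ρN / (1 - ρN) := fun hNx =>
    usage_eq_Uh x (T₁ + T₂) j (m + l) (p + h) ρN hx0 hx1 hbelow hlowN hcompN hNspan hNx
  have hlowS : 2 * (((p + l : ℕ) : ℝ)) < T₁ + T₂ := by push_cast; linarith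
  have hdS : (0 : ℝ) < ((p + h : ℕ) : ℝ) - ((p + l : ℕ) : ℝ) := by push_cast; linarith
  have hcP1 : (T₁ + T₂ < ((p : ℝ) + l) + ((p : ℝ) + h)) ↔ ρS < 1 := by
    constructor
    · intro hc
      have : ρS * ((h : ℝ) - l) < 1 * ((h : ℝ) - l) := by rw [hSE]; linarith
      exact lt_of_mul_lt_mul_right this hE0.le
    · intro hS1
      have : ρS * ((h : ℝ) - l) < 1 * ((h : ℝ) - l) := mul_lt_mul_of_pos_right hS1 hE0
      rw [hSE] at this; linarith
  have hρSx : x ≤ ρS := by rw [hρS]; linarith [div_nonneg (mul_nonneg hr0 ha0.le) hε0.le]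
  have hUP1 : ρS < 1 → usage x (T₁ + T₂) j (p + l) (p + h) = ρS / (1 - ρS) := by
    intro hS1
    have hc : T₁ + T₂ < ((p : ℝ) + l) + ((p : ℝ) + h) := hcP1.2 hS1
    have hcompS : T₁ + T₂ < ((p + l : ℕ) : ℝ) + ((p + h : ℕ) : ℝ) := by push_cast; exact hc
    exact usage_eq_Uh x (T₁ + T₂) j (p + l) (p + h) ρS hx0 hx1 hbelow hlowS hcompS hSspan hρSx
  -- ### masses and the balance identity
  have hK : 0 < (1 - x) / (usage x T₂ j l h - usage x T₂ j l' h') := div_pos h1x (by linarith [c2.trans c1])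
  obtain ⟨mE, hmEdef⟩ : ∃ mE : ℝ, mE = (1 - x) / (usage x T₂ j l h - usage x T₂ j l' h') * (x / (1 - x) - usage x T₂ j l' h') := ⟨_, rfl⟩
  obtain ⟨mC, hmCdef⟩ : ∃ mC : ℝ, mC = (1 - x) / (usage x T₂ j l h - usage x T₂ j l' h') * (usage x T₂ j l h - x / (1 - x)) := ⟨_, rfl⟩
  have hmE : 0 ≤ mE := by rw [hmEdef]; exact mul_nonneg hK.le (by linarith [c2])
  have hmC : 0 < mC := by rw [hmCdef]; exact mul_pos hK (by linarith [c1])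
  have hbal : mE * (usage x T₂ j l h - x / (1 - x)) = mC * (x / (1 - x) - usage x T₂ j l' h') := by
    rw [hmEdef, hmCdef]; ring
  -- ### apply the knapsack form with the cell inequality
  refine lightSlice_decAtT_below_of_twoMid x (T₁ + T₂) T₂ (gateOf x T₁ j p m) M₁ M₂ j p m l h l' h' hx0 hx1 hγ0 hγ1.le
    hc₂0 c2 c1 hpm hll' hh'h hmM a4 hlow hbelow' hbelow htop hM2compat hM1c ?_
  intro β₁ β₂ hβ₁ hβ₂
  rw [← hmEdef, ← hmCdef, hγ]
  have key := TwoMidCell.main x r ρc a ρe ε mE mC (usage x T₂ j l h) (usage x T₂ j l' h')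
    (usage x (T₁ + T₂) j (p + l) (p + h)) (usage x (T₁ + T₂) j (m + l) (p + h))
    (usage x (T₁ + T₂) j (p + l') (p + h')) (usage x (T₁ + T₂) j (m + l') (p + h')) β₁ β₂
    (T₁ + T₂ < ((p : ℝ) + l) + ((p : ℝ) + h)) (T₁ + T₂ < ((p : ℝ) + l') + ((p : ℝ) + h'))
    hx0 hx1 hr0 hrx hρcx ha0 ha1 hlc hρex hρe1 hdII.le hmC hmE hbal hc₁v hc₂v
    (by rw [← hP]; exact hcP2) (by rw [← hP]; exact hUP2l) (by rw [← hP]; exact hUP2h) (by rw [← hM]; exact hM2)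
    (by rw [← hρS]; exact hcP1) (by rw [← hρS]; exact hUP1) (by rw [← hρN]; exact hUM1l) (by rw [← hρN]; exact hUM1h)
    hβ₁ hβ₂
  linarith [key]

end LawDec

end Quant

end Summit.CriticalPhenomena.PercolationContinuityZ3.Theorems
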